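import Literature.LinearAlgebra.Matrix.StableLatticeClassesLowerBound
import Mathlib.NumberTheory.NumberField.Cyclotomic.Basic
import HarnessLib

/-!
# The classes of `T`-stable lattices, IV: the MAXIMAL ORDER `ℤ[θ] = 𝒪_K` — **exactly `h_K` classes**
# (Steinitz; Marseglia 2025 (ANTS XVI) Prop. 3.1 with `R = 𝒪`, Thm. 4.1; the Latimer–MacDuffee–Taussky count in
# every rank)

[topic LinearAlgebra/Matrix] Lane `lit-hodgefound` (Track 2 foundations library), seat p15 generation 39, row g39-#1 —
the EXACT COUNT companion of g38-#4 `StableLatticeClassesIrreducible` (finiteness), g38-#6 (non-vacuity) and g38-#7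
`StableLatticeClassesLowerBound` (`h_K ≤ #classes`).  THEOREMS ONLY (no definition, no instance, no named fact;
D-0026 net Literature debt `0`; no `sorry`).  Steinitz's theorem is the tree's
(`Literature.RingTheory.DedekindDomain.Lattice.exists_linearEquiv_of_classGroupMk_eq`, O'Meara 81:5/81:8), used by
name; the lower bound is g38-#7's `card_classGroup_le_natCard_quot`.

## Sources, VERBATIM

S. Marseglia, *Modules over orders, conjugacy classes of integral matrices, and abelian varieties over finite fields*,
Res. Number Theory 11 (2025) (ANTS XVI) [Marseglia2025ModulesOverOrders], §3 (held `paper:arxiv-2208.05409`, chunk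
p0006): «Denote by `𝓛(R, V)` the category of sub-`R`-modules of `V` which are also lattices, with `R`-linear
morphisms. […] Pick a morphism `φ : M → N` in `𝓛(R, V)`. Since `RQ = 𝒪Q = K` and `MQ = NQ = V`, the morphism `φ`
extends uniquely to a `K`-linear endomorphism of `V` […]. The following is a restatement of Steinitz Theory.
**Proposition 3.1.** Let `M` be in `𝓛(𝒪, V)`. Then there are fractional `𝒪_i`-ideals `I_i` and there exists an
`𝒪`-linear isomorphism `M ≃ ⊕_{i=1}^n (𝒪_i^{s_i−1} ⊕ I_i)`. Moreover, the isomorphism class of `M` is uniquely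
determined by the integers `s_i` and the isomorphism class of the fractional `𝒪`-ideal `I = I₁ ⊕ … ⊕ I_n`.»; §4
(chunks p0008–p0009) **Theorem 4.1**: for `R = ℤ[x]/(m)`, `m` square-free, the `GL_N(ℤ)`-conjugacy classes of
integer matrices with minimal polynomial `m` and characteristic polynomial `h` are in bijection with the
`R`-isomorphism classes of `𝓛(R, V)`.  Hence, for ONE number field (`n = 1`) and `R = 𝒪 = 𝒪_K` — i.e. when the
order `ℤ[θ]` IS the maximal order — the classes of `𝓛(𝒪_K, V)` are the `h_K = #Pic(𝒪_K)` Steinitz classes (every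
class `[I]` occurs, at `𝒪_K^{s−1} ⊕ I`), and the semisimple integer matrices with characteristic polynomial
`P^{s}` (`ℤ[x]/(P) = 𝒪_K`) form exactly `h_K` classes under `GL(ℤ)`: for `s = 1` this is O. Taussky, *On a theorem
of Latimer and MacDuffee*, Canad. J. Math. 1 (1949) [Taussky1949], Thms. 1–4 with `ℤ[α]` maximal («there is a 1-1
correspondence between the classes of matrices and the ideal classes»); I. Reiner, *Maximal Orders*
[Reiner2003MaximalOrders], §26 (26.4) for the finiteness.  O. T. O'Meara, *Introduction to Quadratic Forms*
[Omeara1963], §81 (81:5, 81:8) is the tree's Steinitz theory.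

## What is formalised (one number field `K`; `W` a non-zero finite-dimensional `K`-space — the source's `V = K^s`)

* §1 the hypothesis **`ℤ[θ] = 𝒪_K`** in the tree's vocabulary: `θ` integral and every algebraic integer of `K` lies in
  `ℤ[θ] = Algebra.adjoin ℤ {θ}` (`forall_isIntegral_mem_adjoin_of_adjoin_eq_top` bridges from Mathlib's idiom
  `Algebra.adjoin ℤ {θ} = ⊤` in `𝓞 K`, e.g. `IsCyclotomicExtension.Rat.adjoin_singleton_eq_top`); it forces
  `ℚ(θ) = K` (`adjoin_rat_eq_top_of_forall_isIntegral_mem_adjoin`), and then **a `θ`-stable subgroup is its own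
  `𝒪_K`-hull** (`restrictScalars_span_eq_self`).
* §2 **Prop. 3.1 «uniquely determined» as an `R`-ISOMORPHISM statement for `R = 𝒪_K`**: two `θ`-stable full
  `ℤ`-lattices whose hulls have the same Steinitz class lie in one `GL_K(W)`-orbit
  (`exists_linearEquiv_map_eq_of_classGroupMk_eq`); so the Steinitz class is INJECTIVE on the classes
  (`exists_injective_quot_classGroup`, `natCard_quot_le_card_classGroup`) and, with g38-#7's lower bound,
  **`#{θ-stable full ℤ-lattices of W}/GL_K(W) = h_K`** (`natCard_quot_eq_card_classGroup`) through a bijection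
  (`exists_bijective_quot_classGroup`); non-vacuity instance: every cyclotomic field, `θ = ζ_n`
  (`natCard_quot_eq_card_classGroup_of_isPrimitiveRoot`, Mathlib's `ℤ[ζ_n] = 𝒪`).
* §3 endomorphism language: the commutant of `T` with `ℚ(θ) = K` acting through `T` is `GL_K(W)`
  (`natCard_quot_centralizer_eq_natCard_quot_linearEquiv`, the transfer used inline by g38-#4 §6 / g38-#7 §3, here
  once and for all), so for `T` with `P(T) = 0`, `P` irreducible and `ℤ[x̄] = 𝒪_{ℚ[x]/(P)}`:
  `#{T-stable full ℤ-lattices}/C(T) = h_{ℚ[x]/(P)}` (`natCard_quot_centralizer_eq_card_classGroup`).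
* §4 matrix language (Thm. 4.1 = g38-#3's bijection): for any such model of `χ = c ∈ ℤ[x]`,
  **`#(𝓜/∼_ℤ) = h_{ℚ[x]/(P)}`** (`natCard_quot_conj_eq_card_classGroup`), and MODEL-FREE for `χ = P^{s+1}` through
  g38-#6's integer block-companion matrix (`natCard_quot_conj_pow_eq_card_classGroup`): **the semisimple integer
  matrices with characteristic polynomial `P^{s+1}`, `ℤ[x]/(P)` the maximal order, form exactly `h_{ℚ[x]/(P)}` classes
  under `GL_{(s+1)deg P}(ℤ)`** — Latimer–MacDuffee–Taussky (`s = 0`, the tree's `LatimerMacDuffeeCorrespondence`) in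
  every rank.

Not here: non-maximal orders `ℤ[θ] ⊊ 𝒪_K` (there the count exceeds `h_K` in general and Marseglia's Cor. 3.7 gives
only divisibility by `#Pic(𝒪)` — `-- TODO(general form)` of g38-#7 stands), several simple factors (g38-#5's
gluing), and any class-number value.

## References
* [Marseglia2025ModulesOverOrders] S. Marseglia, Res. Number Theory 11 (2025), §3 Prop. 3.1 (with `R = 𝒪`), §4 Thm. 4.1. [cite: Marseglia2025ModulesOverOrders, §3 Prop. 3.1 and §4 Thm. 4.1, chunks p0006, p0008–p0009]
* [Taussky1949] O. Taussky, Canad. J. Math. 1 (1949), Thms. 1–4.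
* [Omeara1963] O. T. O'Meara, *Introduction to Quadratic Forms*, §81 Prop. 81:5, 81:8, pp. 212–214.
* [Reiner2003MaximalOrders] I. Reiner, *Maximal Orders*, §26 Thm. (26.4).
-/

noncomputable section

open scoped Classical nonZeroDivisors NumberField
open Polynomial Module Submodule

namespace Literature.LinearAlgebra.Matrix.StableLatticeClassesMaximalOrder

open Literature.LinearAlgebra.Matrix.StableLatticeClassesIrreducible
  (exists_basis_pseudoBasis_span finite_quot_linearEquiv_of_smul_mem le_restrictScalars_span smul_mem_of_mem_span)
open Literature.LinearAlgebra.Matrix.StableLatticeClassesLowerBound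
  (classGroupMk_eq_of_linearEquiv mem_span_iff_map_mem_span card_classGroup_le_natCard_quot)
open Literature.RingTheory.DedekindDomain

/-! ## §1 The hypothesis `ℤ[θ] = 𝒪_K` -/

section MaximalOrder

variable {K : Type} [Field K] [NumberField K]

omit [NumberField K] in
/-- **Bridge from Mathlib's idiom.**  If `θ ∈ 𝒪_K` generates the ring of integers, `Algebra.adjoin ℤ {θ} = ⊤` inside
`𝓞 K` (e.g. Mathlib's `IsCyclotomicExtension.Rat.adjoin_singleton_eq_top` for `θ = ζ_n`), then every algebraic
integer of `K` lies in the order `ℤ[θ] ⊆ K`: the form of «`R = 𝒪`» used below. [cite: Marseglia2025ModulesOverOrders, §2 («the maximal order of `K`») and §3 Prop. 3.1, chunks p0005–p0006] -/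
theorem forall_isIntegral_mem_adjoin_of_adjoin_eq_top (θ : 𝓞 K)
    (hθ : Algebra.adjoin ℤ ({θ} : Set (𝓞 K)) = ⊤) (a : K) (ha : IsIntegral ℤ a) :
    a ∈ Algebra.adjoin ℤ ({(θ : K)} : Set K) := by
  obtain ⟨x, rfl⟩ : ∃ x : 𝓞 K, algebraMap (𝓞 K) K x = a := IsIntegralClosure.isIntegral_iff.mp ha
  have h1 : x ∈ Algebra.adjoin ℤ ({θ} : Set (𝓞 K)) := by
    rw [hθ]; exact Algebra.mem_top
  let e : 𝓞 K →ₐ[ℤ] K := IsScalarTower.toAlgHom ℤ (𝓞 K) K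
  have he : ∀ y : 𝓞 K, e y = algebraMap (𝓞 K) K y := fun y => IsScalarTower.toAlgHom_apply ℤ (𝓞 K) K y
  have h2 : algebraMap (𝓞 K) K x ∈ (Algebra.adjoin ℤ ({θ} : Set (𝓞 K))).map e :=
    Subalgebra.mem_map.mpr ⟨x, h1, he x⟩
  rwa [AlgHom.map_adjoin_singleton, he θ, ← NumberField.RingOfIntegers.coe_eq_algebraMap] at h2

/-- `𝒪_K ⊆ ℤ[θ]` forces **`ℚ(θ) = K`** (a `ℤ`-basis of `𝒪_K` is a `ℚ`-basis of `K`). [cite: Marseglia2025ModulesOverOrders, §2 («`RQ = 𝒪Q = K`»), chunk p0005] -/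
theorem adjoin_rat_eq_top_of_forall_isIntegral_mem_adjoin {θ : K}
    (hmax : ∀ a : K, IsIntegral ℤ a → a ∈ Algebra.adjoin ℤ ({θ} : Set K)) :
    Algebra.adjoin ℚ ({θ} : Set K) = ⊤ := by
  have hle : Algebra.adjoin ℤ ({θ} : Set K) ≤ (Algebra.adjoin ℚ ({θ} : Set K)).restrictScalars ℤ :=
    Algebra.adjoin_le Algebra.subset_adjoin
  refine eq_top_iff.mpr fun x _ => ?_
  have hx : x ∈ Submodule.span ℚ (Set.range (NumberField.integralBasis K)) := by
    rw [(NumberField.integralBasis K).span_eq]; exact Submodule.mem_top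
  have hsub : Set.range (NumberField.integralBasis K) ⊆
      (Subalgebra.toSubmodule (Algebra.adjoin ℚ ({θ} : Set K)) : Set K) := by
    rintro _ ⟨i, rfl⟩
    rw [NumberField.integralBasis_apply]
    exact hle (hmax _ (NumberField.RingOfIntegers.isIntegral_coe _))
  exact (Submodule.span_le.mpr hsub) hx

variable {W : Type*} [AddCommGroup W] [Module K W]

omit [NumberField K] in
/-- **When `ℤ[θ] = 𝒪_K`, a `θ`-stable subgroup is its own `𝒪_K`-hull: `M𝒪 = M`** (it is `ℤ[θ]`-stable, g38-#4's
`smul_mem_of_mem_span` with `d = 1`). [cite: Marseglia2025ModulesOverOrders, §3 (for `R = 𝒪`: «`M𝒪` … belongs to `𝓛(𝒪, V)`», `M𝒪 = M`), chunk p0006] -/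
theorem restrictScalars_span_eq_self [Module (𝓞 K) W] [IsScalarTower (𝓞 K) K W] {θ : K}
    (hmax : ∀ a : K, IsIntegral ℤ a → a ∈ Algebra.adjoin ℤ ({θ} : Set K)) {M : Submodule ℤ W}
    (hM : ∀ x ∈ M, θ • x ∈ M) :
    (Submodule.span (𝓞 K) (M : Set W)).restrictScalars ℤ = M := by
  refine le_antisymm (fun x hx => ?_) (le_restrictScalars_span M)
  have h1 : ∀ a : K, IsIntegral ℤ a → (1 : ℤ) • a ∈ Algebra.adjoin ℤ ({θ} : Set K) := fun a ha => by
    rw [one_smul]; exact hmax a ha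
  have h2 : (1 : ℤ) • x ∈ M := smul_mem_of_mem_span (W := W) h1 hM hx
  rwa [one_smul] at h2

end MaximalOrder

/-! ## §2 Prop. 3.1 for `R = 𝒪_K`: the Steinitz class classifies — exactly `h_K` classes -/

section Count

variable {K : Type} [Field K] [NumberField K]
variable {W : Type*} [AddCommGroup W] [Module K W]

/-- **Prop. 3.1 («the isomorphism class of `M` is uniquely determined by … the isomorphism class of `I`») for
`θ`-stable lattices when `ℤ[θ] = 𝒪_K`**: if the hulls `M𝒪 = Σ 𝔞ᵢbᵢ`, `M′𝒪 = Σ 𝔞′ᵢb′ᵢ` have the same Steinitz class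
`[∏ 𝔞ᵢ] = [∏ 𝔞′ᵢ]`, then some `f ∈ GL_K(W)` carries `M` onto `M′` (Steinitz's theorem of the tree moves the hulls;
the hulls are the lattices by §1). [cite: Marseglia2025ModulesOverOrders, §3 Prop. 3.1, chunk p0006] [cite: Omeara1963, §81B Prop. 81:5 and §81C Prop. 81:8, pp. 212–214] -/
theorem exists_linearEquiv_map_eq_of_classGroupMk_eq [Module (𝓞 K) W] [IsScalarTower (𝓞 K) K W] {θ : K}
    (hmax : ∀ a : K, IsIntegral ℤ a → a ∈ Algebra.adjoin ℤ ({θ} : Set K)) {n : ℕ}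
    {M M' : Submodule ℤ W} (hM : ∀ x ∈ M, θ • x ∈ M) (hM' : ∀ x ∈ M', θ • x ∈ M')
    (b b' : Basis (Fin n) K W) (𝔞 𝔞' : Fin n → (FractionalIdeal (𝓞 K)⁰ K)ˣ)
    (hb : ∀ v : W, v ∈ Submodule.span (𝓞 K) (M : Set W) ↔
      ∃ c : Fin n → K, (∀ i, c i ∈ (𝔞 i : FractionalIdeal (𝓞 K)⁰ K)) ∧ v = ∑ i, c i • b i)
    (hb' : ∀ v : W, v ∈ Submodule.span (𝓞 K) (M' : Set W) ↔
      ∃ c : Fin n → K, (∀ i, c i ∈ (𝔞' i : FractionalIdeal (𝓞 K)⁰ K)) ∧ v = ∑ i, c i • b' i)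
    (hSt : ClassGroup.mk K (∏ i, 𝔞 i) = ClassGroup.mk K (∏ i, 𝔞' i)) :
    ∃ f : W ≃ₗ[K] W, M.map ((f : W →ₗ[K] W).restrictScalars ℤ) = M' := by
  obtain ⟨f, hf⟩ := Lattice.exists_linearEquiv_of_classGroupMk_eq b b' 𝔞 𝔞' hb hb' hSt
  refine ⟨f, ?_⟩
  have hMeq := restrictScalars_span_eq_self hmax hM
  have hM'eq := restrictScalars_span_eq_self hmax hM'
  ext y
  constructor
  · rintro ⟨x, hx, rfl⟩
    have hx' : x ∈ Submodule.span (𝓞 K) (M : Set W) := Submodule.subset_span hx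
    have h3 : f x ∈ Submodule.span (𝓞 K) (M' : Set W) := (hf x).1 hx'
    rw [← hM'eq]
    exact h3
  · intro hy
    have hy' : y ∈ Submodule.span (𝓞 K) (M' : Set W) := Submodule.subset_span hy
    have h3 : f.symm y ∈ Submodule.span (𝓞 K) (M : Set W) := by
      rw [hf, LinearEquiv.apply_symm_apply]; exact hy'
    refine ⟨f.symm y, ?_, by simp⟩
    rw [← hMeq]
    exact h3

variable [Module ℚ W] [IsScalarTower ℚ K W] [FiniteDimensional ℚ W]

/-- **The Steinitz class of the hull is INJECTIVE on the `GL_K(W)`-classes of `θ`-stable full `ℤ`-lattices when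
`ℤ[θ] = 𝒪_K`** (it descends by g38-#7 §1; injectivity is `exists_linearEquiv_map_eq_of_classGroupMk_eq`).
[cite: Marseglia2025ModulesOverOrders, §3 Prop. 3.1, chunk p0006] [cite: Omeara1963, §81C Prop. 81:8] -/
theorem exists_injective_quot_classGroup {θ : K}
    (hmax : ∀ a : K, IsIntegral ℤ a → a ∈ Algebra.adjoin ℤ ({θ} : Set K)) :
    ∃ κ : Quot (fun M M' : {M : Submodule ℤ W // M.IsLattice ℚ ∧ ∀ x ∈ M, θ • x ∈ M} =>
        ∃ φ : W ≃ₗ[K] W, M.1.map ((φ : W →ₗ[K] W).restrictScalars ℤ) = M'.1) → ClassGroup (𝓞 K),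
      Function.Injective κ := by
  classical
  letI : Module (𝓞 K) W := Module.compHom W (algebraMap (𝓞 K) K)
  haveI : IsScalarTower (𝓞 K) K W := IsScalarTower.of_algebraMap_smul fun _ _ => rfl
  haveI : Module.Finite K W := Module.Finite.of_restrictScalars_finite ℚ K W
  -- the Steinitz data of every hull (Prop. 3.1)
  have hull : ∀ M : {M : Submodule ℤ W // M.IsLattice ℚ ∧ ∀ x ∈ M, θ • x ∈ M},
      ∃ (b : Basis (Fin (finrank K W)) K W) (𝔞 : Fin (finrank K W) → (FractionalIdeal (𝓞 K)⁰ K)ˣ),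
      ∀ v : W, v ∈ Submodule.span (𝓞 K) (M.1 : Set W) ↔
        ∃ c : Fin (finrank K W) → K, (∀ i, c i ∈ ((𝔞 i : FractionalIdeal (𝓞 K)⁰ K))) ∧
          v = ∑ i, c i • b i := fun M => exists_basis_pseudoBasis_span M.2.1
  choose b 𝔞 hb using hull
  let κ : {M : Submodule ℤ W // M.IsLattice ℚ ∧ ∀ x ∈ M, θ • x ∈ M} → ClassGroup (𝓞 K) :=
    fun M => ClassGroup.mk K (∏ i, 𝔞 M i)
  -- it descends to the classes (g38-#7 §1)
  have hκ : ∀ M M' : {M : Submodule ℤ W // M.IsLattice ℚ ∧ ∀ x ∈ M, θ • x ∈ M},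
      (∃ φ : W ≃ₗ[K] W, M.1.map ((φ : W →ₗ[K] W).restrictScalars ℤ) = M'.1) → κ M = κ M' := by
    rintro M M' ⟨f, hf⟩
    have hf' : ∀ v, v ∈ Submodule.span (𝓞 K) (M.1 : Set W) ↔ f v ∈ Submodule.span (𝓞 K) (M'.1 : Set W) := by
      intro v
      rw [← hf]
      exact mem_span_iff_map_mem_span M.1 f v
    exact classGroupMk_eq_of_linearEquiv (b M) (b M') (𝔞 M) (𝔞 M') (hb M) (hb M') f hf'
  refine ⟨Quot.lift κ hκ, ?_⟩
  rintro ⟨M⟩ ⟨M'⟩ h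
  exact Quot.sound (exists_linearEquiv_map_eq_of_classGroupMk_eq hmax M.2.2 M'.2.2 (b M) (b M') (𝔞 M) (𝔞 M')
    (hb M) (hb M') h)

/-- **AT MOST `h_K` CLASSES when `ℤ[θ] = 𝒪_K`.** [cite: Marseglia2025ModulesOverOrders, §3 Prop. 3.1, chunk p0006] -/
theorem natCard_quot_le_card_classGroup {θ : K}
    (hmax : ∀ a : K, IsIntegral ℤ a → a ∈ Algebra.adjoin ℤ ({θ} : Set K)) :
    Nat.card (Quot (fun M M' : {M : Submodule ℤ W // M.IsLattice ℚ ∧ ∀ x ∈ M, θ • x ∈ M} =>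
        ∃ φ : W ≃ₗ[K] W, M.1.map ((φ : W →ₗ[K] W).restrictScalars ℤ) = M'.1)) ≤
      Fintype.card (ClassGroup (𝓞 K)) := by
  obtain ⟨κ, hκ⟩ := exists_injective_quot_classGroup (K := K) (W := W) hmax
  calc _ ≤ Nat.card (ClassGroup (𝓞 K)) := Nat.card_le_card_of_injective κ hκ
    _ = Fintype.card (ClassGroup (𝓞 K)) := Nat.card_eq_fintype_card

/-- **EXACTLY `h_K` CLASSES (Prop. 3.1 for `R = 𝒪`, one field).**  Let `K = ℚ(θ)` be a number field whose order
`ℤ[θ]` is the full ring of integers `𝒪_K`, and let `W ≠ 0` be a finite-dimensional `K`-vector space.  Then the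
`θ`-stable full `ℤ`-lattices of `W`, modulo the `K`-linear automorphisms of `W`, form **exactly `h_K` classes** — the
Steinitz class of `M = M𝒪_K ≅ 𝒪_K^{s−1} ⊕ I` is a complete invariant and every ideal class occurs.
[cite: Marseglia2025ModulesOverOrders, §3 Prop. 3.1, chunk p0006] [cite: Omeara1963, §81B Prop. 81:5 and §81C Prop. 81:8, pp. 212–214] -/
theorem natCard_quot_eq_card_classGroup [Nontrivial W] {θ : K} (hθ : IsIntegral ℤ θ)
    (hmax : ∀ a : K, IsIntegral ℤ a → a ∈ Algebra.adjoin ℤ ({θ} : Set K)) :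
    Nat.card (Quot (fun M M' : {M : Submodule ℤ W // M.IsLattice ℚ ∧ ∀ x ∈ M, θ • x ∈ M} =>
        ∃ φ : W ≃ₗ[K] W, M.1.map ((φ : W →ₗ[K] W).restrictScalars ℤ) = M'.1)) =
      Fintype.card (ClassGroup (𝓞 K)) :=
  le_antisymm (natCard_quot_le_card_classGroup hmax)
    (card_classGroup_le_natCard_quot hθ (adjoin_rat_eq_top_of_forall_isIntegral_mem_adjoin hmax))

/-- **The Steinitz class is a BIJECTION `{θ-stable full ℤ-lattices of W}/GL_K(W) ≃ Cl(𝒪_K)`** when `ℤ[θ] = 𝒪_K`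
(«uniquely determined by … the isomorphism class of `I`», and every `[I]` occurs). [cite: Marseglia2025ModulesOverOrders, §3 Prop. 3.1, chunk p0006] -/
theorem exists_bijective_quot_classGroup [Nontrivial W] {θ : K} (hθ : IsIntegral ℤ θ)
    (hmax : ∀ a : K, IsIntegral ℤ a → a ∈ Algebra.adjoin ℤ ({θ} : Set K)) :
    ∃ κ : Quot (fun M M' : {M : Submodule ℤ W // M.IsLattice ℚ ∧ ∀ x ∈ M, θ • x ∈ M} =>
        ∃ φ : W ≃ₗ[K] W, M.1.map ((φ : W →ₗ[K] W).restrictScalars ℤ) = M'.1) → ClassGroup (𝓞 K),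
      Function.Bijective κ := by
  obtain ⟨κ, hκ⟩ := exists_injective_quot_classGroup (K := K) (W := W) hmax
  refine ⟨κ, hκ.bijective_of_nat_card_le ?_⟩
  rw [natCard_quot_eq_card_classGroup hθ hmax, Nat.card_eq_fintype_card]

/-- **Non-vacuity: every cyclotomic field.**  For `K = ℚ(ζ_n)` Mathlib knows `ℤ[ζ_n] = 𝒪_K`
(`IsCyclotomicExtension.Rat.adjoin_singleton_eq_top`), so the `ζ_n`-stable full `ℤ`-lattices of any non-zero
finite-dimensional `K`-space form exactly `h(ℚ(ζ_n))` classes under `GL_K(W)`. [cite: Marseglia2025ModulesOverOrders, §3 Prop. 3.1, chunk p0006] -/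
theorem natCard_quot_eq_card_classGroup_of_isPrimitiveRoot [Nontrivial W] {n : ℕ} [NeZero n]
    [IsCyclotomicExtension {n} ℚ K] {ζ : K} (hζ : IsPrimitiveRoot ζ n) :
    Nat.card (Quot (fun M M' : {M : Submodule ℤ W // M.IsLattice ℚ ∧ ∀ x ∈ M, ζ • x ∈ M} =>
        ∃ φ : W ≃ₗ[K] W, M.1.map ((φ : W →ₗ[K] W).restrictScalars ℤ) = M'.1)) =
      Fintype.card (ClassGroup (𝓞 K)) :=
  natCard_quot_eq_card_classGroup (hζ.isIntegral (NeZero.pos n))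
    (forall_isIntegral_mem_adjoin_of_adjoin_eq_top hζ.toInteger
      (IsCyclotomicExtension.Rat.adjoin_singleton_eq_top hζ))

end Count

/-! ## §3 Endomorphism language: the commutant of `T` is `GL_K(W)` for `K = ℚ(θ)` acting through `T` -/

section Endomorphism

/-- **Transfer.**  Let a field `F = ℚ(θ)` act on a `ℚ`-space `W` with `θ` acting as `T`.  Then a `ℚ`-automorphism of
`W` commutes with `T` iff it is `F`-linear, and `T`-stable = `θ`-stable; so the classes of `T`-stable full
`ℤ`-lattices modulo the commutant `C(T)` are the classes of `θ`-stable full `ℤ`-lattices modulo `GL_F(W)` («the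
morphism `φ` extends uniquely to a `K`-linear endomorphism of `V`»; the transfer used inline in g38-#4 §6 and g38-#7
§3). [cite: Marseglia2025ModulesOverOrders, §3 (morphisms of `𝓛(R, V)`) and §4 Thm. 4.1, chunks p0006, p0008] -/
theorem natCard_quot_centralizer_eq_natCard_quot_linearEquiv {F : Type*} [Field F] [Algebra ℚ F]
    {W : Type*} [AddCommGroup W] [Module ℚ W] [Module F W] [IsScalarTower ℚ F W]
    {θ : F} (hgen : Algebra.adjoin ℚ ({θ} : Set F) = ⊤) (T : Module.End ℚ W) (hθ : ∀ w : W, θ • w = T w) :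
    Nat.card (Quot (fun L L' : {L : Submodule ℤ W // L.IsLattice ℚ ∧ ∀ x ∈ L, T x ∈ L} =>
        ∃ φ : W ≃ₗ[ℚ] W, (φ : W →ₗ[ℚ] W) ∘ₗ T = T ∘ₗ (φ : W →ₗ[ℚ] W) ∧
          L.1.map ((φ : W →ₗ[ℚ] W).restrictScalars ℤ) = L'.1)) =
      Nat.card (Quot (fun M M' : {M : Submodule ℤ W // M.IsLattice ℚ ∧ ∀ x ∈ M, θ • x ∈ M} =>
        ∃ φ : W ≃ₗ[F] W, M.1.map ((φ : W →ₗ[F] W).restrictScalars ℤ) = M'.1)) := by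
  set rF := (fun M M' : {M : Submodule ℤ W // M.IsLattice ℚ ∧ ∀ x ∈ M, θ • x ∈ M} =>
    ∃ φ : W ≃ₗ[F] W, M.1.map ((φ : W →ₗ[F] W).restrictScalars ℤ) = M'.1) with hrF
  let e : {L : Submodule ℤ W // L.IsLattice ℚ ∧ ∀ x ∈ L, T x ∈ L} ≃
      {M : Submodule ℤ W // M.IsLattice ℚ ∧ ∀ x ∈ M, θ • x ∈ M} :=
    Equiv.subtypeEquivRight fun L => by simp_rw [hθ]
  refine Nat.card_congr (Quot.congr (rb := rF) e fun L L' => ?_)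
  constructor
  · rintro ⟨φ, hφT, hmap⟩
    -- `φ` commutes with `θ`, hence with `ℚ(θ) = F`: it is `F`-linear
    have hlin : ∀ (a : F) (w : W), φ (a • w) = a • φ w := by
      intro a
      have ha : a ∈ Algebra.adjoin ℚ ({θ} : Set F) := by rw [hgen]; exact Algebra.mem_top
      induction ha using Algebra.adjoin_induction with
      | mem x hx =>
        intro w
        rw [Set.mem_singleton_iff] at hx
        rw [hx, hθ, hθ]
        exact LinearMap.congr_fun hφT w
      | algebraMap r =>
        intro w
        rw [algebraMap_smul, algebraMap_smul, LinearEquiv.map_smul]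
      | add a b _ _ iha ihb =>
        intro w
        rw [add_smul, add_smul, map_add, iha, ihb]
      | mul a b _ _ iha ihb =>
        intro w
        rw [mul_smul, mul_smul, iha, ihb]
    let ψ : W ≃ₗ[F] W :=
      { toFun := φ, invFun := φ.symm, map_add' := fun x y => φ.map_add x y,
        map_smul' := fun a w => hlin a w,
        left_inv := φ.left_inv, right_inv := φ.right_inv }
    refine ⟨ψ, ?_⟩
    have hψ : ((ψ : W →ₗ[F] W).restrictScalars ℤ) = (φ : W →ₗ[ℚ] W).restrictScalars ℤ :=
      LinearMap.ext fun _ => rfl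
    change L.1.map ((ψ : W →ₗ[F] W).restrictScalars ℤ) = L'.1
    rw [hψ]; exact hmap
  · rintro ⟨ψ, hmap⟩
    refine ⟨ψ.restrictScalars ℚ, ?_, ?_⟩
    · ext w
      change ψ (T w) = T (ψ w)
      rw [← hθ, ← hθ, LinearEquiv.map_smul]
    · exact hmap

/-- **Exactly `h_{ℚ[x]/(P)}` classes of `T`-stable lattices modulo `C(T)`** for `T` on a non-zero finite-dimensional
`ℚ`-space `W` with `P(T) = 0`, `P` irreducible, when the order `ℤ[x̄]` of `K = ℚ[x]/(P)` is the maximal order (`x̄`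
an algebraic integer — e.g. `χ_T ∈ ℤ[x]`, see `natCard_quot_conj_eq_card_classGroup` — and `𝒪_K ⊆ ℤ[x̄]`; `K` acting
through `T`, `C(T) = GL_K(W)`). [cite: Marseglia2025ModulesOverOrders, §3 Prop. 3.1 with §4 Thm. 4.1, chunks p0006, p0008–p0009] -/
theorem natCard_quot_centralizer_eq_card_classGroup {W : Type*} [AddCommGroup W] [Module ℚ W]
    [FiniteDimensional ℚ W] [Nontrivial W] (T : Module.End ℚ W) {P : ℚ[X]} [hP : Fact (Irreducible P)]
    (hPT : aeval T P = 0) (hint : IsIntegral ℤ (AdjoinRoot.root P))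
    (hmax : ∀ a : AdjoinRoot P, IsIntegral ℤ a → a ∈ Algebra.adjoin ℤ ({AdjoinRoot.root P} : Set (AdjoinRoot P))) :
    Nat.card (Quot (fun L L' : {L : Submodule ℤ W // L.IsLattice ℚ ∧ ∀ x ∈ L, T x ∈ L} =>
        ∃ φ : W ≃ₗ[ℚ] W, (φ : W →ₗ[ℚ] W) ∘ₗ T = T ∘ₗ (φ : W →ₗ[ℚ] W) ∧
          L.1.map ((φ : W →ₗ[ℚ] W).restrictScalars ℤ) = L'.1)) =
      Fintype.card (ClassGroup (𝓞 (AdjoinRoot P))) := by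
  classical
  -- `K = ℚ[x]/(P)` acting on `W` through `x ↦ T` (as in g38-#4 §6)
  have hI : ∀ q ∈ Ideal.span ({P} : Set ℚ[X]), aeval T q = 0 := fun q hq => by
    obtain ⟨r, rfl⟩ := Ideal.mem_span_singleton'.mp hq
    rw [map_mul, hPT, mul_zero]
  let φK : AdjoinRoot P →ₐ[ℚ] Module.End ℚ W := Ideal.Quotient.liftₐ (Ideal.span {P}) (aeval T) hI
  have hφ_mk : ∀ q : ℚ[X], φK (AdjoinRoot.mk P q) = aeval T q := fun q => rfl
  have hφ_root : φK (AdjoinRoot.root P) = T := by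
    rw [AdjoinRoot.root, hφ_mk, aeval_X]
  letI : Module (AdjoinRoot P) W := Module.compHom W φK.toRingHom
  have hsmul : ∀ (a : AdjoinRoot P) (w : W), a • w = φK a w := fun _ _ => rfl
  haveI : IsScalarTower ℚ (AdjoinRoot P) W := IsScalarTower.of_algebraMap_smul fun q w => by
    have halg : ∀ g : ℚ →+* AdjoinRoot P, φK (g q) = algebraMap ℚ (Module.End ℚ W) q := fun g => by
      rw [Subsingleton.elim g ((AdjoinRoot.mk P).comp C), RingHom.comp_apply, hφ_mk, aeval_C]
    rw [hsmul, halg, Module.algebraMap_end_apply]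
  have hθ : ∀ w : W, AdjoinRoot.root P • w = T w := fun w => by rw [hsmul, hφ_root]
  rw [natCard_quot_centralizer_eq_natCard_quot_linearEquiv AdjoinRoot.adjoinRoot_eq_top T hθ]
  exact natCard_quot_eq_card_classGroup (K := AdjoinRoot P) hint hmax

end Endomorphism

/-! ## §4 Matrix language: `#(𝓜_{P, c}(ℤ)/∼_ℤ) = h_{ℚ[x]/(P)}` for the maximal order -/

section MatrixForm

/-- **Matrix language (Thm. 4.1 with `R = 𝒪`)**: for any model `(V, T)` with `P(T) = 0` (`P` irreducible),
`χ_T = c ∈ ℤ[x]`, `V ≠ 0`, and `𝒪_{ℚ[x]/(P)} ⊆ ℤ[x̄]` (so `ℤ[x̄]`, an order since `x̄` is integral — `c(x̄) = 0` — IS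
the maximal order), the `GL_n(ℤ)`-classes of semisimple integer matrices with characteristic polynomial `c` number
**exactly the class number of `ℚ[x]/(P)`** (g38-#3's bijection `𝓜/∼_ℤ ≃ 𝓛/≃` and §3). [cite: Marseglia2025ModulesOverOrders, §3 Prop. 3.1 and §4 Thm. 4.1, chunks p0006, p0008–p0009] [cite: Taussky1949, Thms. 1–4] -/
theorem natCard_quot_conj_eq_card_classGroup {V : Type*} [AddCommGroup V] [Module ℚ V] [FiniteDimensional ℚ V]
    [Nontrivial V] {n : ℕ} (hn : finrank ℚ V = n) (T : Module.End ℚ V) {P : ℚ[X]} [hP : Fact (Irreducible P)]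
    (hPT : aeval T P = 0) {c : ℤ[X]} (hc : T.charpoly = c.map (Int.castRingHom ℚ))
    (hmax : ∀ a : AdjoinRoot P, IsIntegral ℤ a → a ∈ Algebra.adjoin ℤ ({AdjoinRoot.root P} : Set (AdjoinRoot P))) :
    Nat.card (Quot (fun B B' : {B : _root_.Matrix (Fin n) (Fin n) ℤ //
          Module.End.IsSemisimple (Matrix.toLin' (B.map (Int.castRingHom ℚ))) ∧ B.charpoly = c} =>
        ∃ Q : _root_.Matrix (Fin n) (Fin n) ℤ, IsUnit Q.det ∧ Q * B.1 = B'.1 * Q)) =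
      Fintype.card (ClassGroup (𝓞 (AdjoinRoot P))) := by
  have hT : T.IsSemisimple := Module.End.isSemisimple_of_squarefree_aeval_eq_zero hP.out.squarefree hPT
  have hcm : c.Monic := by
    refine Polynomial.monic_of_injective (Int.castRingHom ℚ).injective_int ?_
    rw [← hc]; exact T.charpoly_monic
  have hcT : aeval T (c.map (Int.castRingHom ℚ)) = 0 := by rw [← hc]; exact T.aeval_self_charpoly
  -- `x̄` is an algebraic integer: `c(x̄) ↦ c(T) = 0` under the injection `K ↪ End_ℚ(V)`, `x ↦ T`
  have hI : ∀ q ∈ Ideal.span ({P} : Set ℚ[X]), aeval T q = 0 := fun q hq => by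
    obtain ⟨r, rfl⟩ := Ideal.mem_span_singleton'.mp hq
    rw [map_mul, hPT, mul_zero]
  let φK : AdjoinRoot P →ₐ[ℚ] Module.End ℚ V := Ideal.Quotient.liftₐ (Ideal.span {P}) (aeval T) hI
  have hφ_mk : ∀ q : ℚ[X], φK (AdjoinRoot.mk P q) = aeval T q := fun q => rfl
  have hφ_root : φK (AdjoinRoot.root P) = T := by
    rw [AdjoinRoot.root, hφ_mk, aeval_X]
  have hinj : Function.Injective φK := φK.toRingHom.injective
  have hint : IsIntegral ℤ (AdjoinRoot.root P) := by
    refine ⟨c, hcm, ?_⟩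
    rw [← Polynomial.aeval_def, ← Polynomial.aeval_map_algebraMap ℚ (AdjoinRoot.root P) c, algebraMap_int_eq]
    apply hinj
    rw [map_zero, ← Polynomial.aeval_algHom_apply, hφ_root, hcT]
  rw [LatimerMacDuffeeSemisimple.natCard_quot_conj_eq_of_isSemisimple hn T hT hc]
  exact natCard_quot_centralizer_eq_card_classGroup T hPT hint hmax

/-- **MODEL-FREE, the isotypic case `χ = P^{s+1}`: the LATIMER–MACDUFFEE–TAUSSKY COUNT IN EVERY RANK.**  For a monic
`P ∈ ℤ[x]` irreducible over `ℚ` whose order `ℤ[x]/(P)` is the maximal order of `ℚ[x]/(P)` (`𝒪 ⊆ ℤ[x̄]`) and any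
`s ≥ 0`, the semisimple integer matrices with characteristic polynomial `P^{s+1}` (size `N = (s+1)·deg P`) form
**exactly `h_{ℚ[x]/(P)}` classes under `B ∼ QBQ⁻¹`, `Q ∈ GL_N(ℤ)`** — for `s = 0` every integer matrix with
characteristic polynomial `P` is semisimple and this is Taussky's «1-1 correspondence between the classes of
matrices and the ideal classes» for `ℤ[α]` maximal (the tree's `LatimerMacDuffeeCorrespondence`); the model is
g38-#6's integer block-companion matrix. [cite: Marseglia2025ModulesOverOrders, §3 Prop. 3.1 and §4 Thm. 4.1, chunks p0006, p0008–p0009] [cite: Taussky1949, Thms. 1–4] -/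
theorem natCard_quot_conj_pow_eq_card_classGroup (P : ℤ[X]) (hP : P.Monic)
    [hirr : Fact (Irreducible (P.map (Int.castRingHom ℚ)))]
    (hmax : ∀ a : AdjoinRoot (P.map (Int.castRingHom ℚ)), IsIntegral ℤ a →
      a ∈ Algebra.adjoin ℤ ({AdjoinRoot.root (P.map (Int.castRingHom ℚ))} : Set (AdjoinRoot (P.map (Int.castRingHom ℚ)))))
    (s : ℕ) :
    Nat.card (Quot (fun B B' : {B : _root_.Matrix (Fin ((s + 1) * P.natDegree)) (Fin ((s + 1) * P.natDegree)) ℤ //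
          Module.End.IsSemisimple (Matrix.toLin' (B.map (Int.castRingHom ℚ))) ∧ B.charpoly = P ^ (s + 1)} =>
        ∃ Q : _root_.Matrix (Fin ((s + 1) * P.natDegree)) (Fin ((s + 1) * P.natDegree)) ℤ,
          IsUnit Q.det ∧ Q * B.1 = B'.1 * Q)) =
      Fintype.card (ClassGroup (𝓞 (AdjoinRoot (P.map (Int.castRingHom ℚ))))) := by
  obtain ⟨⟨B₀, hmin, hchar⟩⟩ := IntegerBlockCompanionMatrices.nonempty_minpoly_charpoly_pow P hP s
  have hdeg : 0 < P.natDegree := by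
    rw [← hP.natDegree_map (Int.castRingHom ℚ)]
    exact Polynomial.natDegree_pos_iff_degree_pos.mpr (Polynomial.degree_pos_of_irreducible hirr.out)
  haveI : Nonempty (Fin ((s + 1) * P.natDegree)) := ⟨⟨0, Nat.mul_pos (Nat.succ_pos s) hdeg⟩⟩
  -- the model `(ℚ^N, B₀)`
  have hPT : aeval (Matrix.toLin' (B₀.map (Int.castRingHom ℚ))) (P.map (Int.castRingHom ℚ)) = 0 := by
    rw [← hmin, ← Matrix.minpoly_toLin']
    exact minpoly.aeval ℚ _
  have hc : (Matrix.toLin' (B₀.map (Int.castRingHom ℚ))).charpoly = (P ^ (s + 1)).map (Int.castRingHom ℚ) := by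
    rw [Matrix.charpoly_toLin', Matrix.charpoly_map, hchar]
  exact natCard_quot_conj_eq_card_classGroup (Module.finrank_fin_fun ℚ) _ hPT hc hmax

end MatrixForm

end Literature.LinearAlgebra.Matrix.StableLatticeClassesMaximalOrder
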